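import Summits.QuantumFields.YangMills.Theorems.FluctuationComparisonRegPrIntLS2BetaCurlBudgetInhabitedR
import HarnessLib

/-!
# S2β · (SCT″-c)₁ — «THE c₁ LETTER UNDER THE TWO PROFILES»: the REAL-ALGEBRA half of (O3-a) — ✓p840622 `c1Budget_inhabitedR`'s class-profile binder
# `haA : acl(i+1)² ≤ A²·(L^{2i}∕L^{2(K−J)})²` (for ✓p840511's class lambda `acl`, `δ` instantiated from (BKG)) INHABITED from TWO level profiles with an EXPLICIT,
# K-UNIFORM constant: the oscillation profile `Olev(i+1) ≤ o·q_i` ((REG-UP)′: ✓p840162 `hOSC_of_compositeLetters`' `O_l = 2(d·3L)·(C·L^{2l}c₀ + β + 2ρ₂)` with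
# `c₀, β, ρ₂ ∝ L^{2l}η²` — px12 g27's (O2-b) chain) and the size profile `(Mb i)² ≤ m²·q_i`, `Mb i ≤ m` (✓p840608 C-M: `Mb i := 2ΛB₁s·L^i·η`), `q_i := L^{2i}∕L^{2(K−J)}`:
# `A := 16B·o∕(15a₀∕16)² + 32B·o∕a₀² + ℓ³m² + 8·67·ℓ·((d−1)·3L·(2(C_B+1)α))·m∕a₀²`, `B = 54ℓ(e^{a₀} − 1)`, `ℓ = (d+2)L` — and the c₁ letter `c1Budget_profiled` with
# `(A, haA)` DISCHARGED: its R-row displays only `hOlev`, `hMbsq`∕`hMbm` (+ `hMb`, `hOSC`, radii windows).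

Cell `ym3-torus` (YM ladder rung R3 = continuum `SU(2)` Yang–Mills on the three-torus at fixed lattice data — a RUNG: NOT d = 4, NOT infinite volume, NOT a mass gap,
NOT Clay).  Width seat `ym-ust-20520-w4` (gen 29); crux `stmt-QuantumFields-20520`, LINE g18-1 S2β; piece (f0)+(f) (OFFER 2026-09-01T03:52:45Z: the algebra half of
(O3-a), so that px12 g27 keeps only the analytic profile letters).  `--kind proof --supports stmt-QuantumFields-20520 --as helper`, count-neutral, DEFINITION-FREE
(0 `def`, 0 `instance`, 0 `notation`, 0 `sorry`, default heartbeats).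

WHAT IS PROVED (sorry-free).  ★`aclBody_le_of_profiles` ∕ ★`aclBody_sq_le_of_profiles` (generic reals; ✓p840511 `rprime_le_class_mul`'s genre one level up: term by term
`(a₀ − Mv)² ≥ (15a₀∕16)²`, `Ol ≤ o·q`, `Mv² ≤ m²·q`, `δv·Mv ≤ (Cθ·q)·m`); ★★`haA_of_profiles (C_B α) (hCB) (hα) (ha0) (Mb hMb0 hMb16) (Olev hO0) (o m ho) (hOlev) (hMbsq)
(hMbm) : ∀ i < K−J, acl (i+1)² ≤ A²·q_i²` — ✓p840622's `haA` text VERBATIM with the explicit `A` (the class lambda's `match` at `i+1` reduces by `rfl`; the instantiated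
`δ(i+1) = 2(C_B+1)α·q_i` by `Nat.add_sub_cancel` + `inv_pow`); ★★★`c1Budget_profiled` = ✓p840622 with `(A : ℝ) (haA)` REPLACED by `(o m : ℝ) (ho : 0 ≤ o) (hOlev) (hMbsq) (hMbm)`
and `A` substituted in the conclusion's R-share `192·d²·A²·S′∕L` — proof `exact c1Budget_inhabitedR … A (haA_of_profiles …) …`.

DOMAIN LINE (plan (3) v4; desk №720 (O3) split: (O3-R) ✓p840511 px20, (O3-a) px12∕px13; architect px17 g23 (S1)∕(S2) 02:00:25Z, 02:19:44Z «target profiles»).  After this file the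
R-row of the c₁ letter is kernel modulo two LEVEL PROFILES in print's currency — `hOlev` (covariant oscillation `∝ L^{2i}η²` at the Thm-2 representative: (REG-UP)′ ∘ (O2-b)
∘ (RES-u) ∘ (R-3), with `B8Thm2AtT3Members` a theorem for `L ≥ 5`, `hThm2S3` at `L = 3`) and `hMbsq`∕`hMbm` (size `∝ L^iη`: ✓p840608's (130)-bootstrap from (1.36)) — plus
`hMb`∕`hOSC` themselves (the same two objects un-profiled, consumed by ✓p840511's `hR`), `hζc`, (T), (BKG), radii windows. [Balaban1985Averaging] (19)–(20) p.21, Prop. 3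
(121)–(125) p.36, Prop. 4 (128)–(135) pp.37–38; [Balaban1985RegularSpaces] Thm 2 (1.36) p.83; [Balaban1987RG1] (0.11), (0.18) pp.253–255.

HONEST SCOPE.  Real algebra + composition by name; nothing of Bałaban's renormalisation-group analysis is asserted or proved; every profile∕window∕letter displayed is a
HYPOTHESIS or others'; GAP♯∘ (`stub_uniformFibreGapOrbit`, registry 3732b7df UNTOUCHED, 0∕5), S2β, the five registered stubs, crux 20520, 19936, 19200 and `YM3TorusSU2` are
NOT proved; no registered stub is closed; rung R3 — NOT d = 4, NOT infinite volume, NOT a mass gap, NOT Clay; the Yang–Mills mass gap is NOT proved.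
-/

set_option autoImplicit false

noncomputable section

open scoped Matrix.Norms.L2Operator
open Finset

namespace Summit.QuantumFields.YangMills.Theorems.FluctuationComparisonRegPrIntLS2BetaCurlBudgetProfiled

open Literature.MathematicalPhysics.QuantumFieldTheory.Balaban1983to89
open Literature.MathematicalPhysics.QuantumFieldTheory.Balaban1983to89.T4Continuum
open Literature.MathematicalPhysics.QuantumFieldTheory.Balaban1983to89.T3ContinuumYM3Torus
open Literature.MathematicalPhysics.QuantumFieldTheory.Balaban1983to89.T3LevelShift
open Literature.MathematicalPhysics.QuantumFieldTheory.Balaban1983to89.T3TiltDescent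
open Literature.MathematicalPhysics.QuantumFieldTheory.Balaban1983to89.T3UnitLawDensityEML (ℰp)
open Literature.MathematicalPhysics.QuantumFieldTheory.Balaban1983to89.T4HaarSU2ExpChart (expPoint)
open Literature.MathematicalPhysics.QuantumFieldTheory.Balaban1983to89.T4ExpWindowSmallField (logVec)
open Literature.MathematicalPhysics.QuantumFieldTheory.Balaban1983to89.HaarExponentialChart
open Literature.MathematicalPhysics.QuantumFieldTheory.Balaban1983to89.HaarExponentialChart.IsChartRep
open Literature.MathematicalPhysics.QuantumFieldTheory.Balaban1983to89.BlockAveraging (Idx blockAvg avgFun loopHol)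
open Literature.MathematicalPhysics.QuantumFieldTheory.Balaban1983to89.ExpMeanLog (expMeanLogSU deltaSU)
open Literature.MathematicalPhysics.QuantumFieldTheory.Balaban1983to89.BlockAveragingEMLLinearisedBackground (covWalkSum)
open Literature.MathematicalPhysics.QuantumFieldTheory.Balaban1983to89.B10Eq47AxialChi (shiftN)
open Literature.MathematicalPhysics.QuantumFieldTheory.Balaban1983to89.B14.Eq22Determines (blockIter)
open Literature.MathematicalPhysics.QuantumFieldTheory.Balaban1983to89.B10Eq27TorusAxialLog (rel)
open Literature.MathematicalPhysics.QuantumFieldTheory.Balaban1983to89.B10Eq18SigmaSU2 (su2Coord)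
open Literature.MathematicalPhysics.QuantumFieldTheory.Balaban1983to89.B10Eq18SigmaSU2Haar (rev)
open Literature.MathematicalPhysics.QuantumLattice (su2Quat)
open Summit.QuantumFields.YangMills.Theorems.FluctuationComparisonRegPrIntLS2BetaChartReadDescentOntoExpPoint (su2Coord_rev_mem_lie)
open Summit.QuantumFields.YangMills.Theorems.FluctuationComparisonRegPrIntLS2BetaCurlBudgetInhabitedR (c1Budget_inhabitedR)
open Summit.QuantumFields.YangMills.Theorems.FluctuationComparisonRegPrIntLS2BetaSourceClassesOfBkg (bkgClass_nonneg)

variable (F : T3Family)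

/-- ★ **THE CLASS BODY UNDER THE TWO PROFILES** (real algebra, ✓p840511 `rprime_le_class_mul`'s genre one level up): with `Ol ≤ o·q`, `Mv² ≤ m²·q`, `Mv ≤ m`,
`δv ≤ Cθ·q`, `16·Mv ≤ a₀` (`0 ≤ q`), ✓p840511's class body at `(Ol, Mv, δv)` is `≤ A·q` with
`A := 16B·o∕(15a₀∕16)² + 32B·o∕a₀² + ℓ³·m² + 8·67·ℓ·(D₁·D₂·Cθ)·m∕a₀²`, `B = 54ℓ(e^{a₀} − 1)`. [cite: Balaban1985Averaging, Prop. 3 (123) p.36, Prop. 4 (128)-(135) pp.37-38] -/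
theorem aclBody_le_of_profiles {ℓ D₁ D₂ a₀ Ol Mv δv q o m Cθ : ℝ} (hℓ : 0 ≤ ℓ) (hD₁ : 0 ≤ D₁) (hD₂ : 0 ≤ D₂) (ha0 : 0 < a₀)
    (hMv0 : 0 ≤ Mv) (hMv16 : 16 * Mv ≤ a₀) (hq0 : 0 ≤ q) (ho : 0 ≤ o) (hCθ : 0 ≤ Cθ)
    (hOl : Ol ≤ o * q) (hMvsq : Mv ^ 2 ≤ m ^ 2 * q) (hMvm : Mv ≤ m) (hδv : δv ≤ Cθ * q) :
    16 * (54 * (ℓ * (Real.exp a₀ - 1))) * Ol / (a₀ - Mv) ^ 2 + 32 * (54 * (ℓ * (Real.exp a₀ - 1))) * Ol / a₀ ^ 2 +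
          ℓ ^ 3 * Mv ^ 2 + 8 * (67 * (ℓ * (D₁ * D₂ * δv))) * Mv / a₀ ^ 2 ≤
      (16 * (54 * (ℓ * (Real.exp a₀ - 1))) * o / (15 * a₀ / 16) ^ 2 + 32 * (54 * (ℓ * (Real.exp a₀ - 1))) * o / a₀ ^ 2 +
          ℓ ^ 3 * m ^ 2 + 8 * (67 * (ℓ * (D₁ * D₂ * Cθ))) * m / a₀ ^ 2) * q := by
  have hB : 0 ≤ 54 * (ℓ * (Real.exp a₀ - 1)) := by
    have : 0 ≤ Real.exp a₀ - 1 := by linarith [Real.add_one_le_exp a₀]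
    positivity
  have hden : 15 * a₀ / 16 ≤ a₀ - Mv := by linarith
  have hden0 : 0 < 15 * a₀ / 16 := by positivity
  have ha2 : 0 < a₀ ^ 2 := by positivity
  -- term 1
  have h1 : 16 * (54 * (ℓ * (Real.exp a₀ - 1))) * Ol / (a₀ - Mv) ^ 2 ≤ 16 * (54 * (ℓ * (Real.exp a₀ - 1))) * o / (15 * a₀ / 16) ^ 2 * q := by
    have hsq : (15 * a₀ / 16) ^ 2 ≤ (a₀ - Mv) ^ 2 := pow_le_pow_left₀ hden0.le hden 2
    calc 16 * (54 * (ℓ * (Real.exp a₀ - 1))) * Ol / (a₀ - Mv) ^ 2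
        ≤ 16 * (54 * (ℓ * (Real.exp a₀ - 1))) * (o * q) / (a₀ - Mv) ^ 2 := by gcongr
      _ ≤ 16 * (54 * (ℓ * (Real.exp a₀ - 1))) * (o * q) / (15 * a₀ / 16) ^ 2 :=
          div_le_div_of_nonneg_left (by positivity) (by positivity) hsq
      _ = 16 * (54 * (ℓ * (Real.exp a₀ - 1))) * o / (15 * a₀ / 16) ^ 2 * q := by ring
  -- term 2
  have h2 : 32 * (54 * (ℓ * (Real.exp a₀ - 1))) * Ol / a₀ ^ 2 ≤ 32 * (54 * (ℓ * (Real.exp a₀ - 1))) * o / a₀ ^ 2 * q := by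
    rw [div_mul_eq_mul_div]
    exact div_le_div_of_nonneg_right (by nlinarith [mul_nonneg hB hq0]) ha2.le
  -- term 3
  have h3 : ℓ ^ 3 * Mv ^ 2 ≤ ℓ ^ 3 * m ^ 2 * q := by
    have hl3 : 0 ≤ ℓ ^ 3 := pow_nonneg hℓ 3
    calc ℓ ^ 3 * Mv ^ 2 ≤ ℓ ^ 3 * (m ^ 2 * q) := by gcongr
      _ = ℓ ^ 3 * m ^ 2 * q := by ring
  -- term 4
  have h4 : 8 * (67 * (ℓ * (D₁ * D₂ * δv))) * Mv / a₀ ^ 2 ≤ 8 * (67 * (ℓ * (D₁ * D₂ * Cθ))) * m / a₀ ^ 2 * q := by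
    rw [div_mul_eq_mul_div]
    refine div_le_div_of_nonneg_right ?_ ha2.le
    have hc : 0 ≤ 8 * (67 * (ℓ * (D₁ * D₂))) := by positivity
    have hδm : δv * Mv ≤ Cθ * q * m := mul_le_mul hδv hMvm hMv0 (by positivity)
    calc 8 * (67 * (ℓ * (D₁ * D₂ * δv))) * Mv = 8 * (67 * (ℓ * (D₁ * D₂))) * (δv * Mv) := by ring
      _ ≤ 8 * (67 * (ℓ * (D₁ * D₂))) * (Cθ * q * m) := by gcongr
      _ = 8 * (67 * (ℓ * (D₁ * D₂ * Cθ))) * m * q := by ring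
  calc _ ≤ 16 * (54 * (ℓ * (Real.exp a₀ - 1))) * o / (15 * a₀ / 16) ^ 2 * q + 32 * (54 * (ℓ * (Real.exp a₀ - 1))) * o / a₀ ^ 2 * q +
          ℓ ^ 3 * m ^ 2 * q + 8 * (67 * (ℓ * (D₁ * D₂ * Cθ))) * m / a₀ ^ 2 * q := by linarith
    _ = _ := by ring

/-- ★ Squared edition: `body² ≤ A²·q²` (the shape ✓p840010's `ha` and ✓p840622's `haA` carry). [cite: Balaban1985Averaging, Prop. 4 (128)-(135) pp.37-38] -/
theorem aclBody_sq_le_of_profiles {ℓ D₁ D₂ a₀ Ol Mv δv q o m Cθ : ℝ} (hℓ : 0 ≤ ℓ) (hD₁ : 0 ≤ D₁) (hD₂ : 0 ≤ D₂) (ha0 : 0 < a₀)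
    (hMv0 : 0 ≤ Mv) (hMv16 : 16 * Mv ≤ a₀) (hOl0 : 0 ≤ Ol) (hq0 : 0 ≤ q) (ho : 0 ≤ o) (hCθ : 0 ≤ Cθ)
    (hOl : Ol ≤ o * q) (hMvsq : Mv ^ 2 ≤ m ^ 2 * q) (hMvm : Mv ≤ m) (hδv0 : 0 ≤ δv) (hδv : δv ≤ Cθ * q) :
    (16 * (54 * (ℓ * (Real.exp a₀ - 1))) * Ol / (a₀ - Mv) ^ 2 + 32 * (54 * (ℓ * (Real.exp a₀ - 1))) * Ol / a₀ ^ 2 +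
          ℓ ^ 3 * Mv ^ 2 + 8 * (67 * (ℓ * (D₁ * D₂ * δv))) * Mv / a₀ ^ 2) ^ 2 ≤
      (16 * (54 * (ℓ * (Real.exp a₀ - 1))) * o / (15 * a₀ / 16) ^ 2 + 32 * (54 * (ℓ * (Real.exp a₀ - 1))) * o / a₀ ^ 2 +
          ℓ ^ 3 * m ^ 2 + 8 * (67 * (ℓ * (D₁ * D₂ * Cθ))) * m / a₀ ^ 2) ^ 2 * q ^ 2 := by
  have h := aclBody_le_of_profiles hℓ hD₁ hD₂ ha0 hMv0 hMv16 hq0 ho hCθ hOl hMvsq hMvm hδv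
  have hB : 0 ≤ 54 * (ℓ * (Real.exp a₀ - 1)) := by
    have : 0 ≤ Real.exp a₀ - 1 := by linarith [Real.add_one_le_exp a₀]
    positivity
  have hden : 0 < a₀ - Mv := by linarith
  have h0 : 0 ≤ 16 * (54 * (ℓ * (Real.exp a₀ - 1))) * Ol / (a₀ - Mv) ^ 2 + 32 * (54 * (ℓ * (Real.exp a₀ - 1))) * Ol / a₀ ^ 2 +
          ℓ ^ 3 * Mv ^ 2 + 8 * (67 * (ℓ * (D₁ * D₂ * δv))) * Mv / a₀ ^ 2 := by positivity
  rw [← mul_pow]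
  exact pow_le_pow_left₀ h0 h 2

/-- ★★ **THE CLASS PROFILE FROM THE TWO PROFILES** — ✓p840622 `c1Budget_inhabitedR`'s `haA` binder INHABITED: for ✓p840511's class lambda `acl` (with `δ (i'+1) :=
2·((C_B+1)·α·L^(2i')·(L⁻¹)^(2(K−J)))` as ✓p840622 instantiates it), the oscillation profile `Olev(i+1) ≤ o·q_i` and the size profile `(Mb i)² ≤ m²·q_i`, `Mb i ≤ m`
(`q_i := L^{2i}∕L^{2(K−J)}`) give `acl(i+1)² ≤ A²·q_i²` with the EXPLICIT K-uniform
`A := 16B·o∕(15a₀∕16)² + 32B·o∕a₀² + ℓ³m² + 8·67·ℓ·((d−1)·3L·(2(C_B+1)α))·m∕a₀²`. [cite: Balaban1985Averaging, Prop. 3 (123) p.36, Prop. 4 (128)-(135) pp.37-38] -/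
theorem haA_of_profiles {J K : ℕ} (C_B α : ℝ) (hCB : 0 ≤ C_B) (hα : 0 < α)
    {a₀ : ℝ} (ha0 : 0 < a₀)
    (Mb : ℕ → ℝ) (hMb0 : ∀ i, i < K - J → 0 ≤ Mb i) (hMb16 : ∀ i, i < K - J → 16 * Mb i ≤ a₀)
    (Olev : ℕ → ℝ) (hO0 : ∀ i, i < K - J → 0 ≤ Olev (i + 1))
    (o m : ℝ) (ho : 0 ≤ o)
    (hOlev : ∀ i, i < K - J → Olev (i + 1) ≤ o * ((F.L : ℝ) ^ (2 * i) / (F.L : ℝ) ^ (2 * (K - J))))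
    (hMbsq : ∀ i, i < K - J → Mb i ^ 2 ≤ m ^ 2 * ((F.L : ℝ) ^ (2 * i) / (F.L : ℝ) ^ (2 * (K - J))))
    (hMbm : ∀ i, i < K - J → Mb i ≤ m) :
    ∀ i, i < K - J → (fun (i : ℕ) => match i with
      | 0 => (0 : ℝ)
      | i' + 1 => 16 * (54 * (((((F.P K).d + 2) * (F.P K).L : ℕ) : ℝ) * (Real.exp a₀ - 1))) * Olev (i' + 1) / (a₀ - Mb i') ^ 2 + 32 * (54 * (((((F.P K).d + 2) * (F.P K).L : ℕ) : ℝ) * (Real.exp a₀ - 1))) * Olev (i' + 1) / a₀ ^ 2 +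
          ((((F.P K).d + 2) * (F.P K).L : ℕ) : ℝ) ^ 3 * (Mb i') ^ 2 + 8 * (67 * (((((F.P K).d + 2) * (F.P K).L : ℕ) : ℝ) * ((((F.P K).d - 1 : ℕ) : ℝ) * ((3 * (F.P K).L : ℕ) : ℝ) * (fun n : ℕ => 2 * ((C_B + 1) * α * (F.L : ℝ) ^ (2 * (n - 1)) * ((F.L : ℝ)⁻¹) ^ (2 * (K - J)))) (i' + 1)))) * Mb i' / a₀ ^ 2 : ℕ → ℝ) (i + 1) ^ 2 ≤
      (16 * (54 * (((((F.P K).d + 2) * (F.P K).L : ℕ) : ℝ) * (Real.exp a₀ - 1))) * o / (15 * a₀ / 16) ^ 2 + 32 * (54 * (((((F.P K).d + 2) * (F.P K).L : ℕ) : ℝ) * (Real.exp a₀ - 1))) * o / a₀ ^ 2 +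
          ((((F.P K).d + 2) * (F.P K).L : ℕ) : ℝ) ^ 3 * m ^ 2 + 8 * (67 * (((((F.P K).d + 2) * (F.P K).L : ℕ) : ℝ) * ((((F.P K).d - 1 : ℕ) : ℝ) * ((3 * (F.P K).L : ℕ) : ℝ) * (2 * ((C_B + 1) * α))))) * m / a₀ ^ 2) ^ 2 * ((F.L : ℝ) ^ (2 * i) / (F.L : ℝ) ^ (2 * (K - J))) ^ 2 := by
  have hL2 : (2 : ℝ) ≤ (F.L : ℝ) := by exact_mod_cast F.hL.2
  have hL1 : (1 : ℝ) ≤ (F.L : ℝ) := by linarith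
  have hL0 : (0 : ℝ) < (F.L : ℝ) := by linarith
  have hCB1 : (0 : ℝ) ≤ C_B + 1 := by linarith
  intro i hi
  have hq0 : 0 ≤ ((F.L : ℝ) ^ (2 * i) / (F.L : ℝ) ^ (2 * (K - J))) := by positivity
  have hδv0 : 0 ≤ (fun n : ℕ => 2 * ((C_B + 1) * α * (F.L : ℝ) ^ (2 * (n - 1)) * ((F.L : ℝ)⁻¹) ^ (2 * (K - J)))) (i + 1) := mul_nonneg zero_le_two (bkgClass_nonneg F (C_B + 1) α hCB1 hα.le _)
  have hδv : (fun n : ℕ => 2 * ((C_B + 1) * α * (F.L : ℝ) ^ (2 * (n - 1)) * ((F.L : ℝ)⁻¹) ^ (2 * (K - J)))) (i + 1) ≤ (2 * ((C_B + 1) * α)) * ((F.L : ℝ) ^ (2 * i) / (F.L : ℝ) ^ (2 * (K - J))) := by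
    show 2 * ((C_B + 1) * α * (F.L : ℝ) ^ (2 * (i + 1 - 1)) * ((F.L : ℝ)⁻¹) ^ (2 * (K - J))) ≤ _
    rw [Nat.add_sub_cancel, inv_pow, div_eq_mul_inv]
    exact le_of_eq (by ring)
  exact aclBody_sq_le_of_profiles (Nat.cast_nonneg _) (Nat.cast_nonneg _) (Nat.cast_nonneg _) ha0 (hMb0 i hi) (hMb16 i hi) (hO0 i hi) hq0 ho
    (by positivity) (hOlev i hi) (hMbsq i hi) (hMbm i hi) hδv0 hδv

/-- ★★★ **THE c₁ LETTER UNDER THE TWO PROFILES** — ✓p840622 `c1Budget_inhabitedR` with `(A, haA)` DISCHARGED by ✓`haA_of_profiles`: the R-row now displays only the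
oscillation profile `hOlev` and the size profile `hMbsq`∕`hMbm` (+ `hMb`, `hOSC`, radii windows), with the explicit K-uniform `A`; see the module header.
[cite: Balaban1985Averaging, (19)-(20) p.21, Prop. 3 (123), Prop. 4 (128)-(135) pp.37-38; Balaban1985RegularSpaces, Thm 2 (1.36) p.83; Balaban1987RG1, (0.11), (0.18) pp.253-255] -/
theorem c1Budget_profiled {J K : ℕ} (hJK : J ≤ K) (Cst : ℝ) (hCst : 0 ≤ Cst)
    (U₀ : GaugeField (F.P K) 0 (Matrix.specialUnitaryGroup (Fin 2) ℂ)) (ζ : PBond (F.P K) 0 → EuclideanSpace ℝ (Fin 3))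
    (X : (i : ℕ) → PBond (F.P K) i → (specialUnitaryLogChart (Fin 2)).lie)
    (hXdef : X = fun (i : ℕ) (b : PBond (F.P K) i) =>
      (⟨su2Coord (rev (logVec (su2Quat (Averaging.iter (fun k => BlockAveraging.blockAvg (P := F.P K) (j := k) ℰp) i (fun ℓ => expPoint (ζ ℓ) * U₀ ℓ : GaugeField (F.P K) 0 (Matrix.specialUnitaryGroup (Fin 2) ℂ)) b * (Averaging.iter (fun k => BlockAveraging.blockAvg (P := F.P K) (j := k) ℰp) i U₀ b)⁻¹)))), su2Coord_rev_mem_lie _⟩ : (specialUnitaryLogChart (Fin 2)).lie))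
    (Mg : ℕ → ℝ) (hMg : ∀ t, t ≤ K - J → ∀ b : PBond (F.P K) t,
      ‖logVec (su2Quat (Averaging.iter (fun k => BlockAveraging.blockAvg (P := F.P K) (j := k) ℰp) t (fun ℓ => expPoint (ζ ℓ) * U₀ ℓ : GaugeField (F.P K) 0 (Matrix.specialUnitaryGroup (Fin 2) ℂ)) b * (Averaging.iter (fun k => BlockAveraging.blockAvg (P := F.P K) (j := k) ℰp) t U₀ b)⁻¹))‖ ≤ Mg t)
    (hMg4 : ∀ t, t ≤ K - J → Mg t ≤ 1 / 4)
    (C_B α : ℝ) (hCB : 0 ≤ C_B) (hα : 0 < α)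
    (hBKG : ∀ t, t ≤ K - J → ∀ p : Plaq (F.P K) t,
      dist1 (GaugeField.plaqHol (Averaging.iter (fun k => BlockAveraging.blockAvg (P := F.P K) (j := k) ℰp) t U₀) p) ≤
        C_B * α * (F.L : ℝ) ^ (2 * t) * ((F.L : ℝ)⁻¹) ^ (2 * (K - J)))
    (h24 : ((((F.P K).d + 2) * (F.P K).L : ℕ) : ℝ) ^ 2 / 4 * ((C_B + 1) * α) ≤ 1 / 24)
    (hSU : ((((F.P K).d + 2) * (F.P K).L : ℕ) : ℝ) ^ 2 / 4 * ((C_B + 1) * α) < deltaSU (Fin 2))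
    {ρr : ℝ} (hρ0 : 0 < ρr) (hρr : ρr ≤ innerRadius (specialUnitaryLogChart (Fin 2)))
    {a₀ : ℝ} (ha0 : 0 < a₀) (ha : 100 * (((((F.P K).d + 2) * (F.P K).L : ℕ) : ℝ) * (Real.exp a₀ - 1)) ≤ ρr)
    (Mb : ℕ → ℝ) (hMb0 : ∀ i, i < K - J → 0 ≤ Mb i) (hMb : ∀ i, i < K - J → ∀ b : PBond (F.P K) i, ‖X i b‖ ≤ Mb i) (hMb16 : ∀ i, i < K - J → 16 * Mb i ≤ a₀)
    (Olev : ℕ → ℝ) (hO0 : ∀ i, i < K - J → 0 ≤ Olev (i + 1))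
    (hOSC : ∀ μ ν : Fin (F.P K).d, μ < ν → ∀ i, i < K - J → ∀ (y' : Site (F.P K) (i + 1)) (b b' : PBond (F.P K) i), (blockOf b.src = y' ∨ blockOf b.src = y'.shift μ ∨ blockOf b.src = y'.shift ν ∨ blockOf b.src = (y'.shift μ).shift ν) → (blockOf b'.src = y' ∨ blockOf b'.src = y'.shift μ ∨ blockOf b'.src = y'.shift ν ∨ blockOf b'.src = (y'.shift μ).shift ν) → b.dir = b'.dir →
      ‖(((T4AxialGaugeSmallField.axialGauge (Averaging.iter (fun k => BlockAveraging.blockAvg (P := F.P K) (j := k) ℰp) i U₀) (fun κ : Fin (F.P K).d => (((emb y' κ).val : ℕ) : ℤ) - ((((F.P K).L - 1) / 2 : ℕ) : ℤ)) (fun κ : Fin (F.P K).d => (((emb y' κ).val : ℕ) : ℤ) + (((if κ = μ then ((F.P K).L : ℤ) else 0) + (if κ = ν then ((F.P K).L : ℤ) else 0)) + ((((F.P K).L - 1) / 2 : ℕ) : ℤ)) + 1)) b.src : Matrix.specialUnitaryGroup (Fin 2) ℂ) : Matrix (Fin 2) (Fin 2) ℂ) * ((X i b : (specialUnitaryLogChart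 (Fin 2)).lie) : Matrix (Fin 2) (Fin 2) ℂ) * star (((T4AxialGaugeSmallField.axialGauge (Averaging.iter (fun k => BlockAveraging.blockAvg (P := F.P K) (j := k) ℰp) i U₀) (fun κ : Fin (F.P K).d => (((emb y' κ).val : ℕ) : ℤ) - ((((F.P K).L - 1) / 2 : ℕ) : ℤ)) (fun κ : Fin (F.P K).d => (((emb y' κ).val : ℕ) : ℤ) + (((if κ = μ then ((F.P K).L : ℤ) else 0) + (if κ = ν then ((F.P K).L : ℤ) else 0)) + ((((F.P K).L - 1) / 2 : ℕ) : ℤ)) + 1)) b.src : Matrix.specialUnitaryGroup (Fin 2) ℂ) : Matrix (Fin 2) (Fin 2) ℂ) -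
        ((((T4AxialGaugeSmallField.axialGauge (Averaging.iter (fun k => BlockAveraging.blockAvg (P := F.P K) (j := k) ℰp) i U₀) (fun κ : Fin (F.P K).d => (((emb y' κ).val : ℕ) : ℤ) - ((((F.P K).L - 1) / 2 : ℕ) : ℤ)) (fun κ : Fin (F.P K).d => (((emb y' κ).val : ℕ) : ℤ) + (((if κ = μ then ((F.P K).L : ℤ) else 0) + (if κ = ν then ((F.P K).L : ℤ) else 0)) + ((((F.P K).L - 1) / 2 : ℕ) : ℤ)) + 1)) b'.src : Matrix.specialUnitaryGroup (Fin 2) ℂ) : Matrix (Fin 2) (Fin 2) ℂ) * ((X i b' : (specialUnitaryLogChart (Fin 2)).lie) : Matrix (Fin 2) (Fin 2) ℂ) * star (((T4AxialGaugeSmallField.axialGauge (Averaging.iter (fun k => BlockAveraging.blockAvg (P := F.P K) (j := k) ℰp) i U₀) (fun κ : Fin (F.P K).d => (((emb y' κ).val : ℕ) : ℤ) - ((((F.P K).L - 1) / 2 : ℕ) : ℤ)) (fun κ : Fin (F.P K).d => (((emb y' κ).val : ℕ) : ℤ) + (((if κ = μ then ((F.P K).L : ℤ) else 0) + (if κ =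 ν then ((F.P K).L : ℤ) else 0)) + ((((F.P K).L - 1) / 2 : ℕ) : ℤ)) + 1)) b'.src : Matrix.specialUnitaryGroup (Fin 2) ℂ) : Matrix (Fin 2) (Fin 2) ℂ))‖ ≤ Olev (i + 1))
    (hρα : 4 * ((((((F.P K).d + 2) * (F.P K).L : ℕ) : ℝ) ^ 2 / 4) * (2 * ((C_B + 1) * α))) ≤ ρr)
    (hρδ : 100 * (((((F.P K).d + 2) * (F.P K).L : ℕ) : ℝ) * ((((F.P K).d - 1 : ℕ) : ℝ) * ((3 * (F.P K).L : ℕ) : ℝ) * (2 * ((C_B + 1) * α)))) ≤ ρr)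
    (o m : ℝ) (ho : 0 ≤ o)
    (hOlev : ∀ i, i < K - J → Olev (i + 1) ≤ o * ((F.L : ℝ) ^ (2 * i) / (F.L : ℝ) ^ (2 * (K - J))))
    (hMbsq : ∀ i, i < K - J → Mb i ^ 2 ≤ m ^ 2 * ((F.L : ℝ) ^ (2 * i) / (F.L : ℝ) ^ (2 * (K - J))))
    (hMbm : ∀ i, i < K - J → Mb i ≤ m)
    (c : ℝ) (hc0 : 0 ≤ c) (hc4 : 4 * c ≤ 1)
    (hζc : ∀ ℓ : PBond (F.P K) 0, ‖ζ ℓ‖ ≤ c * ((F.L : ℝ)⁻¹) ^ (K - J))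
    (Mbar : ℝ) (hM0 : 0 ≤ Mbar) (hM1 : 4 * Mbar ≤ 1)
    (hM : ∀ s, s < K - J → ∀ b : PBond (F.P K) s, ‖logVec (su2Quat (Averaging.iter (fun k => BlockAveraging.blockAvg (P := F.P K) (j := k) ℰp) s (fun ℓ => expPoint (ζ ℓ) * U₀ ℓ : GaugeField (F.P K) 0 (Matrix.specialUnitaryGroup (Fin 2) ℂ)) b * (Averaging.iter (fun k => BlockAveraging.blockAvg (P := F.P K) (j := k) ℰp) s U₀ b)⁻¹))‖ ≤ Mbar) :
    ∑ t ∈ Finset.range (K - J), (F.L : ℝ) ^ t * (fun t => Cst * ∑ B : PBond (F.P J) 0,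
      ‖(fun p : Plaq (F.P K) (K - J - 1 - t) =>
        if ∃ z₀ : Site (F.P K) 0, (blockIter (K - J) z₀ = (bondShift (F.sitesPerDir_eq (m := F.m) (K := J) (j := 0) (m' := F.m) (K' := K) (j' := K - J) (by omega)) B).src ∨
            blockIter (K - J) z₀ = (bondShift (F.sitesPerDir_eq (m := F.m) (K := J) (j := 0) (m' := F.m) (K' := K) (j' := K - J) (by omega)) B).tgt) ∧
            ∀ κ, (rel (blockIter (K - J - 1 - t) z₀) p.src κ).natAbs ≤ (2 * F.L + 1)
        then dist1 ((GaugeField.plaqHol (Averaging.iter (fun k => BlockAveraging.blockAvg (P := F.P K) (j := k) ℰp) (K - J - 1 - t) U₀) p)⁻¹ *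
          GaugeField.plaqHol (Averaging.iter (fun k => BlockAveraging.blockAvg (P := F.P K) (j := k) ℰp) (K - J - 1 - t)
            (fun ℓ => expPoint (ζ ℓ) * U₀ ℓ : GaugeField (F.P K) 0 (Matrix.specialUnitaryGroup (Fin 2) ℂ))) p)
        else 0)‖ ^ 2) t ≤
      2 * ((2 * Cst * (((5 ^ (F.P K).d : ℕ) : ℝ) ^ 2 * (((2 * ((2 * F.L + 1) + 2) + 1) ^ (F.P K).d * 6 : ℕ) : ℝ) *
              (2 * ((((F.P K).L ^ (F.P K).d : ℕ) : ℝ) - 1) / ((((F.P K).L ^ (F.P K).d : ℕ) : ℝ) - 3)))) * (4 * (F.L : ℝ)⁻¹ * ((F.L : ℝ) ^ (K - J) * ∑ p : Plaq (F.P K) 0,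
                  (1 - reTr ((GaugeField.plaqHol U₀ p)⁻¹ * GaugeField.plaqHol (fun ℓ => expPoint (ζ ℓ) * U₀ ℓ : GaugeField (F.P K) 0 (Matrix.specialUnitaryGroup (Fin 2) ℂ)) p))) + 7 *
      (12 * ((F.P K).d : ℝ) ^ 2 * (2 * ((F.P K).L : ℝ) ^ 2 * (3 * (F.P K).L + 2) + 2 * ((F.P K).L : ℝ) ^ 2 + (48 * (F.P K).L + 24 * ((((F.P K).d + 2) * (F.P K).L : ℕ) : ℝ) + 1616 * ((((F.P K).d + 2) * (F.P K).L : ℕ) : ℝ)) * (((((F.P K).d + 2) * (F.P K).L : ℕ) : ℝ) ^ 2 / 4) +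
        2 * ((((F.P K).d + 2) * (F.P K).L : ℕ) : ℝ) * ((F.L : ℝ) ^ 2)) ^ 2 * (2 * ((C_B + 1) * α)) ^ 2 *
        (∑ t ∈ Finset.range (K - J), (if ht : t < K - J then
          (F.L : ℝ) ^ t * ∑ B : PBond (F.P J) 0,
            ‖(fun ℓ' : PBond (F.P (J + (t + 1))) 0 =>
              if ∃ z : Site (F.P (J + (t + 1))) 0,
                (B14.Eq22Determines.blockIter (t + 1) z = (bondShift (F.sitesPerDir_eq (m := F.m) (K := J) (j := 0) (m' := F.m) (K' := J + (t + 1)) (j' := t + 1) (by omega)) B).src ∨ B14.Eq22Determines.blockIter (t + 1) z = (bondShift (F.sitesPerDir_eq (m := F.m) (K := J) (j := 0) (m' := F.m) (K' := J + (t + 1)) (j' := t + 1) (by omega)) B).tgt) ∧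
                ∀ ν, (B10Eq27TorusAxialLog.rel z ℓ'.src ν).natAbs ≤ 2
              then logVec (su2Quat (descendTo F ℰp (J + (t + 1)) K (by omega) (fun ℓ => expPoint (ζ ℓ) * U₀ ℓ : GaugeField (F.P K) 0 (Matrix.specialUnitaryGroup (Fin 2) ℂ)) ℓ' * (descendTo F ℰp (J + (t + 1)) K (by omega) U₀ ℓ')⁻¹)) else 0)‖ ^ 2
        else 0)) / (F.L : ℝ) +
      (192 * ((F.P K).d : ℝ) ^ 2 *
        (16 * (54 * (((((F.P K).d + 2) * (F.P K).L : ℕ) : ℝ) * (Real.exp a₀ - 1))) * o / (15 * a₀ / 16) ^ 2 + 32 * (54 * (((((F.P K).d + 2) * (F.P K).L : ℕ) : ℝ) * (Real.exp a₀ - 1))) * o / a₀ ^ 2 +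
          ((((F.P K).d + 2) * (F.P K).L : ℕ) : ℝ) ^ 3 * m ^ 2 + 8 * (67 * (((((F.P K).d + 2) * (F.P K).L : ℕ) : ℝ) * ((((F.P K).d - 1 : ℕ) : ℝ) * ((3 * (F.P K).L : ℕ) : ℝ) * (2 * ((C_B + 1) * α))))) * m / a₀ ^ 2) ^ 2 *
        (∑ t ∈ Finset.range (K - J), (if ht : t < K - J then
          (F.L : ℝ) ^ t * ∑ B : PBond (F.P J) 0,
            ‖(fun ℓ' : PBond (F.P (J + (t + 1))) 0 =>
              if ∃ z : Site (F.P (J + (t + 1))) 0,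
                (B14.Eq22Determines.blockIter (t + 1) z = (bondShift (F.sitesPerDir_eq (m := F.m) (K := J) (j := 0) (m' := F.m) (K' := J + (t + 1)) (j' := t + 1) (by omega)) B).src ∨ B14.Eq22Determines.blockIter (t + 1) z = (bondShift (F.sitesPerDir_eq (m := F.m) (K := J) (j := 0) (m' := F.m) (K' := J + (t + 1)) (j' := t + 1) (by omega)) B).tgt) ∧
                ∀ ν, (B10Eq27TorusAxialLog.rel z ℓ'.src ν).natAbs ≤ 2
              then logVec (su2Quat (descendTo F ℰp (J + (t + 1)) K (by omega) (fun ℓ => expPoint (ζ ℓ) * U₀ ℓ : GaugeField (F.P K) 0 (Matrix.specialUnitaryGroup (Fin 2) ℂ)) ℓ' * (descendTo F ℰp (J + (t + 1)) K (by omega) U₀ ℓ')⁻¹)) else 0)‖ ^ 2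
        else 0)) / (F.L : ℝ)) +
      3 * ((768 * c ^ 2 * (F.L : ℝ)) *
        (((F.L : ℝ)⁻¹) ^ (K - J) * ∑ ℓ : PBond (F.P K) 0, ‖ζ ℓ‖ ^ 2 +
          (F.L : ℝ) ^ (K - J) * ∑ p : Plaq (F.P K) 0,
            (1 - reTr ((GaugeField.plaqHol U₀ p)⁻¹ * GaugeField.plaqHol (fun ℓ => expPoint (ζ ℓ) * U₀ ℓ : GaugeField (F.P K) 0 (Matrix.specialUnitaryGroup (Fin 2) ℂ)) p))))))) +
      2 * ((256 * Cst * Mbar ^ 2 * ((2 * (F.P J).d * (2 * 3 + 1) ^ (F.P J).d : ℕ) : ℝ)) * (∑ t ∈ Finset.range (K - J), (if ht : t < K - J then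
          (F.L : ℝ) ^ t * ∑ B : PBond (F.P J) 0,
            ‖(fun ℓ' : PBond (F.P (J + (t + 1))) 0 =>
              if ∃ z : Site (F.P (J + (t + 1))) 0,
                (B14.Eq22Determines.blockIter (t + 1) z = (bondShift (F.sitesPerDir_eq (m := F.m) (K := J) (j := 0) (m' := F.m) (K' := J + (t + 1)) (j' := t + 1) (by omega)) B).src ∨ B14.Eq22Determines.blockIter (t + 1) z = (bondShift (F.sitesPerDir_eq (m := F.m) (K := J) (j := 0) (m' := F.m) (K' := J + (t + 1)) (j' := t + 1) (by omega)) B).tgt) ∧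
                ∀ ν, (B10Eq27TorusAxialLog.rel z ℓ'.src ν).natAbs ≤ 2
              then logVec (su2Quat (descendTo F ℰp (J + (t + 1)) K (by omega) (fun ℓ => expPoint (ζ ℓ) * U₀ ℓ : GaugeField (F.P K) 0 (Matrix.specialUnitaryGroup (Fin 2) ℂ)) ℓ' * (descendTo F ℰp (J + (t + 1)) K (by omega) U₀ ℓ')⁻¹)) else 0)‖ ^ 2
        else 0))) := by
  exact c1Budget_inhabitedR F hJK Cst hCst U₀ ζ X hXdef Mg hMg hMg4 C_B α hCB hα hBKG h24 hSU hρ0 hρr ha0 ha Mb hMb0 hMb hMb16 Olev hO0 hOSC hρα hρδ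
    (16 * (54 * (((((F.P K).d + 2) * (F.P K).L : ℕ) : ℝ) * (Real.exp a₀ - 1))) * o / (15 * a₀ / 16) ^ 2 + 32 * (54 * (((((F.P K).d + 2) * (F.P K).L : ℕ) : ℝ) * (Real.exp a₀ - 1))) * o / a₀ ^ 2 +
          ((((F.P K).d + 2) * (F.P K).L : ℕ) : ℝ) ^ 3 * m ^ 2 + 8 * (67 * (((((F.P K).d + 2) * (F.P K).L : ℕ) : ℝ) * ((((F.P K).d - 1 : ℕ) : ℝ) * ((3 * (F.P K).L : ℕ) : ℝ) * (2 * ((C_B + 1) * α))))) * m / a₀ ^ 2)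
    (haA_of_profiles F C_B α hCB hα ha0 Mb hMb0 hMb16 Olev hO0 o m ho hOlev hMbsq hMbm) c hc0 hc4 hζc Mbar hM0 hM1 hM

end Summit.QuantumFields.YangMills.Theorems.FluctuationComparisonRegPrIntLS2BetaCurlBudgetProfiled

end
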